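import Summits.CriticalPhenomena.PercolationContinuityZ3.Theorems.PercNearOneGluingNoHeavyLowerTailSahiSunflowerRowPoly
import Summits.CriticalPhenomena.PercolationContinuityZ3.Theorems.PercNearOneGluingNoHeavyLowerTailSahiSunflowerMerge
import Mathlib.Tactic.Linarith
import Mathlib.Tactic.Ring
import HarnessLib

/-!
# `NoHeavyLowerTail` (crux stmt-CriticalPhenomena-4575), master-family line P2 (Sahi's algebraic route):
# the CLOSED FORM of the sunflower row for every `m` — `E_n(D) = J_n(a; c)` — and HEREDITY of `row ≥ 0` under the merge maps

Support file (seat `prim-masterthm-p2`, gen 4; `--supports stmt-CriticalPhenomena-4575`); no definition, no named fact, no sorry.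
Memo SAHI-ROUTE.md §4.10(a) (closed form, paper proof by Sahi's generating function), §4.13 (this gen: proof by the Lieb–Sahi recursion).

* `sahiE_sunflowerCompl_eq_rowJ` — for ANY finite weighted set `(α, μ)`, ANY `n ≥ 1` and any sunflower structure (outside `O`, pairwise disjoint
  petals `C_0,…,C_{n−1}` disjoint from `O`; complements of the members `D_i = O ∪ ⋃_{l≠i} C_l`):
  `E_n(χ_{D_0},…,χ_{D_{n−1}}) = J_n(a; c)` with `c_i = μ(C_i)`, `a = 1 − μ(O) − Σ_l c_l` (for a probability weight: the mass of the rest,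
  the "core").  Proof: induction on `n` along the Lieb–Sahi recursion — peeling `D_0`, the slot `D_i ∩ D_0` is the complement family of the
  sunflower with petal `0` merged into petal `i`, the tail is the one with petal `0` merged into the outside, `E(χ_{D_0}) = 1 − a − c_0`, and
  `rowJ_cons_eq_sum_update` is exactly this recursion for `J`.
* `row_eq_rowJ` — on `Sun m` (every `m ≥ 1`, every weight): `E_m(χ_{U([m]∖0)},…) = J_m(1 − ν out − Σ ν(pet ·); ν(pet ·))`.
* **HEREDITY** (`row_pushWeight_merge_out_nonneg`, `row_pushWeight_merge_pet_nonneg`): for a probability weight `ν ≥ 0` on `Sun m` with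
  `E_m(row) ≥ 0`, the push-forwards along `merge j out` and `merge j (pet x)` (`x ≠ j`) again have `E_m(row) ≥ 0` — by `rowJ_le_update_zero`,
  `rowJ_le_merge` (the merged weights have petal-mass vectors `c[j ↦ 0]`, `c[x ↦ c_x + c_j][j ↦ 0]` and the same core mass).
-/

namespace Summit.CriticalPhenomena.PercolationContinuityZ3.Theorems.SahiDeltaSystem

open Finset Function Literature.Combinatorics.Sahi2008

namespace Sun

section General

variable {α : Type*} [Fintype α] [DecidableEq α]

/-- `E(χ_A) = Σ_{x ∈ A} μ(x)`. [this work] -/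
theorem ex_setInd_eq_sum (μ : α → ℝ) (A : Finset α) : ex μ (setInd A) = ∑ x ∈ A, μ x := by
  rw [ex_def]
  simp only [setInd_apply, mul_ite, mul_one, mul_zero]
  rw [Finset.sum_ite_mem, Finset.univ_inter]

omit [Fintype α] in
/-- Mass of the complement set `D_i = O ∪ ⋃_{l ∈ s} C_l` of a sunflower structure: `μ(O) + Σ_{l∈s} μ(C_l)`. [this work] -/
theorem sum_union_biUnion_eq (μ : α → ℝ) {n : ℕ} (O : Finset α) (C : Fin n → Finset α) (s : Finset (Fin n))
    (hOC : ∀ l, Disjoint O (C l)) (hCC : ∀ l l', l ≠ l' → Disjoint (C l) (C l')) :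
    ∑ x ∈ O ∪ s.biUnion C, μ x = (∑ x ∈ O, μ x) + ∑ l ∈ s, ∑ x ∈ C l, μ x := by
  rw [Finset.sum_union ((Finset.disjoint_biUnion_right _ _ _).2 fun l _ => hOC l),
    Finset.sum_biUnion fun l _ l' _ hll' => hCC l l' hll']

omit [Fintype α] in
/-- Membership in a complement set. [this work] -/
theorem mem_union_biUnion_erase {n : ℕ} (O : Finset α) (C : Fin n → Finset α) (i : Fin n) (y : α) :
    y ∈ O ∪ (univ.erase i).biUnion C ↔ y ∈ O ∨ ∃ l, l ≠ i ∧ y ∈ C l := by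
  simp [Finset.mem_biUnion, and_comm]

omit [Fintype α] in
/-- **Peeling `D_0`, the tail**: `D_{i+1} = (O ∪ C_0) ∪ ⋃_{l' ≠ i} C_{l'+1}` — petal `0` merged into the outside. [this work] -/
theorem compl_succ_eq {n : ℕ} (O : Finset α) (C : Fin (n + 1) → Finset α) (i : Fin n) :
    O ∪ (univ.erase i.succ).biUnion C = (O ∪ C 0) ∪ (univ.erase i).biUnion (fun l => C l.succ) := by
  ext y
  rw [mem_union_biUnion_erase, mem_union_biUnion_erase, Finset.mem_union]
  constructor
  · rintro (hO | ⟨l, hl, hy⟩)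
    · exact Or.inl (Or.inl hO)
    · rcases Fin.eq_zero_or_eq_succ l with rfl | ⟨l', rfl⟩
      · exact Or.inl (Or.inr hy)
      · exact Or.inr ⟨l', fun h => hl (by rw [h]), hy⟩
  · rintro ((hO | h0) | ⟨l', hl', hy⟩)
    · exact Or.inl hO
    · exact Or.inr ⟨0, (Fin.succ_ne_zero i).symm, h0⟩
    · exact Or.inr ⟨l'.succ, fun h => hl' (Fin.succ_injective _ h), hy⟩

omit [Fintype α] in
/-- **Peeling `D_0`, the product slot**: `D_{i+1} ∩ D_0 = O ∪ ⋃_{l' ≠ i} C''_{l'}` with `C'' = (C_{·+1})[i ↦ C_{i+1} ∪ C_0]` — petal `0` merged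
into petal `i+1` (uses disjointness of the petals). [this work] -/
theorem compl_succ_inter_compl_zero_eq {n : ℕ} (O : Finset α) (C : Fin (n + 1) → Finset α) (i : Fin n)
    (hCC : ∀ l l', l ≠ l' → Disjoint (C l) (C l')) :
    (O ∪ (univ.erase i.succ).biUnion C) ∩ (O ∪ (univ.erase (0 : Fin (n + 1))).biUnion C) =
      O ∪ (univ.erase i).biUnion (update (fun l => C l.succ) i (C i.succ ∪ C 0)) := by
  ext y
  rw [Finset.mem_inter, mem_union_biUnion_erase, mem_union_biUnion_erase, mem_union_biUnion_erase]
  constructor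
  · rintro ⟨hO | ⟨l, hl, hy⟩, h2⟩
    · exact Or.inl hO
    · rcases h2 with hO | ⟨l2, hl2, hy2⟩
      · exact Or.inl hO
      · have hll2 : l = l2 := by
          by_contra hne
          exact Finset.disjoint_left.1 (hCC l l2 hne) hy hy2
        subst hll2
        rcases Fin.eq_zero_or_eq_succ l with rfl | ⟨l', rfl⟩
        · exact absurd rfl hl2
        · have hl'i : l' ≠ i := fun h => hl (by rw [h])
          exact Or.inr ⟨l', hl'i, by rw [update_of_ne hl'i]; exact hy⟩
  · rintro (hO | ⟨l', hl', hy⟩)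
    · exact ⟨Or.inl hO, Or.inl hO⟩
    · rw [update_of_ne hl'] at hy
      exact ⟨Or.inr ⟨l'.succ, fun h => hl' (Fin.succ_injective _ h), hy⟩, Or.inr ⟨l'.succ, Fin.succ_ne_zero _, hy⟩⟩

omit [Fintype α] in
/-- **Peeling `D_0`, the untouched slots of the product family**: for `l ≠ i`, `O ∪ ⋃_{l' ≠ l} C''_{l'} = D_{l+1}`. [this work] -/
theorem compl_update_eq_of_ne {n : ℕ} (O : Finset α) (C : Fin (n + 1) → Finset α) {i l : Fin n} (hli : l ≠ i) :
    O ∪ (univ.erase l).biUnion (update (fun l => C l.succ) i (C i.succ ∪ C 0)) = O ∪ (univ.erase l.succ).biUnion C := by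
  ext y
  rw [mem_union_biUnion_erase, mem_union_biUnion_erase]
  constructor
  · rintro (hO | ⟨l', hl', hy⟩)
    · exact Or.inl hO
    · by_cases hl'i : l' = i
      · subst hl'i
        rw [update_self, Finset.mem_union] at hy
        rcases hy with hy | hy
        · exact Or.inr ⟨l'.succ, fun h => hl' (Fin.succ_injective _ h), hy⟩
        · exact Or.inr ⟨0, (Fin.succ_ne_zero l).symm, hy⟩
      · rw [update_of_ne hl'i] at hy
        exact Or.inr ⟨l'.succ, fun h => hl' (Fin.succ_injective _ h), hy⟩
  · rintro (hO | ⟨k, hk, hy⟩)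
    · exact Or.inl hO
    · rcases Fin.eq_zero_or_eq_succ k with rfl | ⟨k', rfl⟩
      · exact Or.inr ⟨i, Ne.symm hli, by rw [update_self]; exact Finset.mem_union_right _ hy⟩
      · have hk'l : k' ≠ l := fun h => hk (by rw [h])
        by_cases hk'i : k' = i
        · subst hk'i
          exact Or.inr ⟨k', hk'l, by rw [update_self]; exact Finset.mem_union_left _ hy⟩
        · exact Or.inr ⟨k', hk'l, by rw [update_of_ne hk'i]; exact hy⟩

/-- **CLOSED FORM OF THE SUNFLOWER ROW, every `n`.**  For any weight `μ` on a finite set, an outside set `O` and pairwise disjoint petals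
`C_0,…,C_n` disjoint from `O`, Sahi's functional of the complements `D_i = O ∪ ⋃_{l ≠ i} C_l` is the row polynomial:
`E_{n+1}(χ_{D_0},…,χ_{D_n}) = J_{n+1}(a; c)`, `c_i = μ(C_i)`, `a = 1 − μ(O) − Σ_l μ(C_l)`. [this work] -/
theorem sahiE_sunflowerCompl_eq_rowJ (μ : α → ℝ) : ∀ (n : ℕ) (O : Finset α) (C : Fin (n + 1) → Finset α),
    (∀ l, Disjoint O (C l)) → (∀ l l', l ≠ l' → Disjoint (C l) (C l')) →
      sahiE μ (n + 1) (fun i => setInd (O ∪ (univ.erase i).biUnion C)) =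
        rowJ (n + 1) (1 - (∑ x ∈ O, μ x) - ∑ l, ∑ x ∈ C l, μ x) (fun i => ∑ x ∈ C i, μ x)
  | 0, O, C, hOC, hCC => by
    rw [sahiE_one_apply, rowJ_one, ex_setInd_eq_sum]
    have h0 : (univ.erase (0 : Fin 1)).biUnion C = ∅ := by
      have he : (univ : Finset (Fin 1)).erase 0 = ∅ := by decide
      rw [he, Finset.biUnion_empty]
    rw [h0, Finset.union_empty, Fin.sum_univ_one]
    ring
  | n + 1, O, C, hOC, hCC => by
    -- abbreviations
    set F : Fin (n + 2) → α → ℝ := fun i => setInd (O ∪ (univ.erase i).biUnion C) with hF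
    set c : Fin (n + 2) → ℝ := fun i => ∑ x ∈ C i, μ x with hc
    set a : ℝ := 1 - (∑ x ∈ O, μ x) - ∑ l, c l with ha
    -- the two smaller sunflower structures
    have hOC' : ∀ l : Fin (n + 1), Disjoint (O ∪ C 0) (C l.succ) := fun l =>
      Finset.disjoint_union_left.2 ⟨hOC _, hCC _ _ (Fin.succ_ne_zero l).symm⟩
    have hCC' : ∀ l l' : Fin (n + 1), l ≠ l' → Disjoint (C l.succ) (C l'.succ) := fun l l' h =>
      hCC _ _ fun e => h (Fin.succ_injective _ e)
    have htail : Fin.tail F = fun i => setInd ((O ∪ C 0) ∪ (univ.erase i).biUnion fun l => C l.succ) := by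
      funext i; show F i.succ = _; rw [hF]; dsimp only; rw [compl_succ_eq]
    have hpar1 : 1 - (∑ x ∈ O ∪ C 0, μ x) - ∑ l : Fin (n + 1), ∑ x ∈ C l.succ, μ x = a := by
      rw [ha, Finset.sum_union (hOC 0), Fin.sum_univ_succ c]
      simp only [hc]
      ring
    have hE_tail : sahiE μ (n + 1) (Fin.tail F) = rowJ (n + 1) a (Fin.tail c) := by
      rw [htail, sahiE_sunflowerCompl_eq_rowJ μ n (O ∪ C 0) (fun l => C l.succ) hOC' hCC', hpar1]
      rfl
    have hE_upd : ∀ i : Fin (n + 1), sahiE μ (n + 1) (update (Fin.tail F) i (Fin.tail F i * F 0)) =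
        rowJ (n + 1) a (update (Fin.tail c) i (Fin.tail c i + c 0)) := by
      intro i
      set C'' : Fin (n + 1) → Finset α := update (fun l => C l.succ) i (C i.succ ∪ C 0) with hC''
      have hOC'' : ∀ l, Disjoint O (C'' l) := by
        intro l; by_cases hl : l = i
        · subst hl; rw [hC'', update_self]; exact Finset.disjoint_union_right.2 ⟨hOC _, hOC _⟩
        · rw [hC'', update_of_ne hl]; exact hOC _
      have hCC'' : ∀ l l', l ≠ l' → Disjoint (C'' l) (C'' l') := by
        intro l l' hll'
        by_cases hl : l = i
        · subst hl
          have hl' : l' ≠ l := Ne.symm hll'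
          rw [hC'', update_self, update_of_ne hl']
          exact Finset.disjoint_union_left.2 ⟨hCC' _ _ hll', hCC _ _ (Fin.succ_ne_zero l').symm⟩
        · by_cases hl' : l' = i
          · subst hl'
            rw [hC'', update_self, update_of_ne hl]
            exact Finset.disjoint_union_right.2 ⟨hCC' _ _ hll', hCC _ _ (Fin.succ_ne_zero l)⟩
          · rw [hC'', update_of_ne hl, update_of_ne hl']; exact hCC' _ _ hll'
      have hfam : update (Fin.tail F) i (Fin.tail F i * F 0) = fun l => setInd (O ∪ (univ.erase l).biUnion C'') := by
        funext l
        by_cases hl : l = i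
        · subst hl
          rw [update_self]
          show F l.succ * F 0 = _
          rw [hF]; dsimp only
          rw [setInd_mul, compl_succ_inter_compl_zero_eq O C l hCC]
        · rw [update_of_ne hl]
          show F l.succ = _
          rw [hF]; dsimp only
          rw [compl_update_eq_of_ne O C hl]
      rw [hfam, sahiE_sunflowerCompl_eq_rowJ μ n O C'' hOC'' hCC'']
      have hmass : ∀ l, (∑ x ∈ C'' l, μ x) = update (Fin.tail c) i (Fin.tail c i + c 0) l := by
        intro l
        by_cases hl : l = i
        · subst hl
          rw [hC'', update_self, update_self, Finset.sum_union (hCC _ _ (Fin.succ_ne_zero l))]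
          rfl
        · rw [hC'', update_of_ne hl, update_of_ne hl]; rfl
      have hmass' : (fun l => ∑ x ∈ C'' l, μ x) = update (Fin.tail c) i (Fin.tail c i + c 0) := funext hmass
      -- the core parameter is unchanged
      have hpar2 : 1 - (∑ x ∈ O, μ x) - ∑ l, ∑ x ∈ C'' l, μ x = a := by
        have h1 : ∑ l, ∑ x ∈ C'' l, μ x = ∑ l, c l := by
          rw [Finset.sum_congr rfl fun l _ => hmass l, Finset.sum_update_of_mem (Finset.mem_univ i),
            Finset.sdiff_singleton_eq_erase, Fin.sum_univ_succ c,
            ← Finset.add_sum_erase Finset.univ (fun l : Fin (n + 1) => c l.succ) (Finset.mem_univ i)]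
          simp only [Fin.tail]
          ring
        rw [h1, ha]
      congr 1
    have hE0 : ex μ (F 0) = 1 - a - c 0 := by
      rw [hF]; dsimp only
      rw [ex_setInd_eq_sum, sum_union_biUnion_eq μ O C _ hOC hCC, ha, Finset.sum_erase_eq_sub (Finset.mem_univ _)]
      ring
    rw [sahiE_succ_succ, hE_tail, hE0]
    simp_rw [hE_upd]
    have hcc : c = Fin.cons (c 0) (Fin.tail c) := (Fin.cons_self_tail c).symm
    conv_rhs => rw [hcc]
    rw [rowJ_cons_eq_sum_update]
    ring

end General

/-! ## The row of `Sun m` and its heredity under merges -/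

variable {m : ℕ}

/-- The top row family of `Sun (n+1)` is a sunflower-complement structure with outside `{out}` and singleton petals. [this work] -/
theorem U_erase_eq_compl (i : Fin m) :
    U (univ.erase i) = {out} ∪ (univ.erase i).biUnion (fun l => ({pet l} : Finset (Sun m))) := by
  ext y
  rcases y with _ | l | _
  · simp
  · simp [Finset.mem_biUnion]
  · simp

/-- **The row of `Sun m` in closed form** (every `m ≥ 1`, every weight): `E_m(χ_{U([m]∖i)} : i) = J_m(1 − ν out − Σ_l ν(pet l); ν(pet ·))`.
[this work] -/
theorem row_eq_rowJ (ν : Sun (m + 1) → ℝ) :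
    sahiE ν (m + 1) (fun i => setInd (U (univ.erase i))) = rowJ (m + 1) (1 - ν out - ∑ l, ν (pet l)) (fun i => ν (pet i)) := by
  have h := sahiE_sunflowerCompl_eq_rowJ ν m {out} (fun l => ({pet l} : Finset (Sun (m + 1))))
    (fun l => by simp) (fun l l' h => by simp [pet_injective.ne h])
  simp only [Finset.sum_singleton] at h
  have hfam : (fun i : Fin (m + 1) => setInd (U (univ.erase i))) =
      fun i => setInd ({out} ∪ (univ.erase i).biUnion fun l => ({pet l} : Finset (Sun (m + 1)))) := by
    funext i; rw [U_erase_eq_compl]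
  rw [hfam, h]

/-- For a probability weight the core parameter is `ν core`. [this work] -/
theorem core_eq_one_sub {ν : Sun m → ℝ} (hν1 : ∑ y, ν y = 1) : ν core = 1 - ν out - ∑ l, ν (pet l) := by
  rw [sum_eq] at hν1; linarith

/-- **The row of a probability weight**: `E_m(row) = J_m(ν core; ν(pet ·))`. [this work] -/
theorem row_eq_rowJ_core {ν : Sun (m + 1) → ℝ} (hν1 : ∑ y, ν y = 1) :
    sahiE ν (m + 1) (fun i => setInd (U (univ.erase i))) = rowJ (m + 1) (ν core) (fun i => ν (pet i)) := by
  rw [row_eq_rowJ, ← core_eq_one_sub hν1]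

/-- **HEREDITY under the outside merge**: if `E_m(row) ≥ 0` for `ν` then also for `(merge j out)_* ν`. [this work] -/
theorem row_pushWeight_merge_out_nonneg {ν : Sun m → ℝ} (hν0 : ∀ y, 0 ≤ ν y) (hν1 : ∑ y, ν y = 1) (j : Fin m)
    (hrow : 0 ≤ sahiE ν m (fun i => setInd (U (univ.erase i)))) :
    0 ≤ sahiE (pushWeight ν (merge j out)) m (fun i => setInd (U (univ.erase i))) := by
  cases m with
  | zero => exact absurd j.isLt (Nat.not_lt_zero _)
  | succ m =>
    have hν1' : ∑ y, pushWeight ν (merge j out) y = 1 := by rw [sum_pushWeight_merge, hν1]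
    rw [row_eq_rowJ_core hν1', pushWeight_merge_core ν j (by simp), petMass_merge_out]
    rw [row_eq_rowJ_core hν1] at hrow
    exact hrow.trans (rowJ_le_update_zero (hν0 core) (fun i => hν0 _) j)

/-- **HEREDITY under a petal merge**: if `E_m(row) ≥ 0` for `ν` then also for `(merge j (pet x))_* ν`, `x ≠ j`. [this work] -/
theorem row_pushWeight_merge_pet_nonneg {ν : Sun m → ℝ} (hν0 : ∀ y, 0 ≤ ν y) (hν1 : ∑ y, ν y = 1) {j x : Fin m} (hxj : x ≠ j)
    (hrow : 0 ≤ sahiE ν m (fun i => setInd (U (univ.erase i)))) :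
    0 ≤ sahiE (pushWeight ν (merge j (pet x))) m (fun i => setInd (U (univ.erase i))) := by
  match m, ν, hν0, hν1, j, x, hxj, hrow with
  | 0, _, _, _, j, _, _, _ => exact absurd j.isLt (Nat.not_lt_zero _)
  | 1, _, _, _, j, x, hxj, _ => exact absurd (Subsingleton.elim x j) hxj
  | m + 2, ν, hν0, hν1, j, x, hxj, hrow =>
    have hν1' : ∑ y, pushWeight ν (merge j (pet x)) y = 1 := by rw [sum_pushWeight_merge, hν1]
    rw [row_eq_rowJ_core hν1', pushWeight_merge_core ν j (by simp), petMass_merge_pet ν hxj]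
    rw [row_eq_rowJ_core hν1] at hrow
    exact hrow.trans (rowJ_le_merge (hν0 core) (fun i => hν0 _) hxj)

end Sun
end Summit.CriticalPhenomena.PercolationContinuityZ3.Theorems.SahiDeltaSystem
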